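import Summits.FinalStateConjecture.FinalStateConjecture.Theorems.SwallowTheDatumParametricKerrBurialLine
import Literature.Geometry.Lorentzian.AFEndBreathingData
import Literature.Geometry.Lorentzian.AFEndUnbreathe
import Literature.Geometry.Lorentzian.AdmissibleDataLocality
import HarnessLib

/-!
# `ParametricKerrBurial`, line `receding-annulus-universal-collar` — stub `stub_breathing`
# (crux item stmt-FinalStateConjecture-10052)

The registered stub `stub_breathing` of the lead's skeleton (reshape v2), proved verbatim: from a
radius-indexed family `P R` (`R > R⋆`) of admissible Kerr-shielded data on `X` agreeing with the
datum `d` off the far region `e.far R`, with sections jointly smooth in `(R, x)`, produce the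
two-parameter family `S (R, t)`, the one-parameter family `E t` through `d = E 0`, and a marker
`(x₀, v₀)` making `t ↦ h_{E t}(x₀)(v₀, v₀)` injective — the ingredients of the junction lemma.

Construction (breathing): inside the coordinate shell `{R < ‖coord‖ < R⋆}` of the end `e` choose a
coordinate ball (`AFEnd.BreathingData`, centre `z₀ = (R + δ/2) e₁`, radius `δ/8`, `δ = R⋆ − R`) and
let `Φ_t = breathe (σ t)` be the breathing diffeomorphisms of `X` supported in it
(`AFEndBreathing`, `AFEndUnbreathe`); set `E t := Φ_t^* d` and `S (R, t) := Φ_t^* (P R)`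
(`AFEnd.breatheFamily`, `AFEndBreathingData`). Then: `E 0 = d`; the families are jointly smooth
(`contMDiff_breatheFamily_h/k`; for `S`, on the carrier `S (R, t) = E t` because `P R = d` there,
off the moved set `S (R, t) = P R`); `S (R, t) = E t` off `e.far R` (both are pullbacks of data
agreeing at the image point); the marker `h_{E t}(x₀)(v₀,v₀) = (1 + σ t)² h_d(x₀)(v₀,v₀)` is
injective (`injective_marker`); `S (R, t)` is admissible (vacuum by naturality, the end by
`AdmissibleDataLocality`) and Kerr-shielded — the shield of `P R` is carried through the breathing
diffeomorphism (`isKerrShielded_comap_of_inverse`, chart `Φ_t⁻¹ ∘ φ`, same Kerr data).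

References: the route file `Theses/SwallowTheDatum.lean` (item 10052); Lines/receding-annulus-
universal-collar.md; Lee, *Introduction to Smooth Manifolds* (2013), Ch. 9; O'Neill 1983, Ch. 3.
-/

-- the doubled `FinalStateConjecture` path component is the summit/problem naming scheme, not a mistake
set_option linter.dupNamespace false

noncomputable section

namespace Summit.FinalStateConjecture.FinalStateConjecture.Theorems.SwallowTheDatum.ParametricKerrBurial

open scoped Manifold ContDiff Topology
open Bundle Set Filter Function Metric Literature.Geometry.Lorentzian Literature.Geometry.Manifold

variable {X : Type} [TopologicalSpace X] [ChartedSpace E3 X] [IsManifold (𝓡 3) ∞ X]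

/-! ## §1 The shielding predicate is invariant under pullback by diffeomorphisms -/

/-- **Pointwise chain rule for pullbacks of bilinear forms**: `((g ∘ f)^* b)_y = (f^*(g^* b))_y`
when `f` is differentiable at `y` and `g` at `f y`. O'Neill 1983, Ch. 3, p. 58.
[cite: ONeill1983, Ch. 3, p. 58] -/
theorem pullbackBilin_comp_apply_of_mdifferentiableAt
    {EN : Type*} [NormedAddCommGroup EN] [NormedSpace ℝ EN] {HN : Type*} [TopologicalSpace HN]
    {IN : ModelWithCorners ℝ EN HN} {N : Type*} [TopologicalSpace N] [ChartedSpace HN N]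
    {EM : Type*} [NormedAddCommGroup EM] [NormedSpace ℝ EM] {HM : Type*} [TopologicalSpace HM]
    {IM : ModelWithCorners ℝ EM HM} {M : Type*} [TopologicalSpace M] [ChartedSpace HM M]
    {EP : Type*} [NormedAddCommGroup EP] [NormedSpace ℝ EP] {HP : Type*} [TopologicalSpace HP]
    {IP : ModelWithCorners ℝ EP HP} {P : Type*} [TopologicalSpace P] [ChartedSpace HP P]
    {f : N → M} {g : M → P} {y : N}
    (hg : MDifferentiableAt IM IP g (f y)) (hf : MDifferentiableAt IN IM f y)
    (b : Π z : P, TangentSpace IP z →L[ℝ] TangentSpace IP z →L[ℝ] ℝ) :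
    pullbackBilin (I := IP) (I' := IN) (g ∘ f) b y =
      pullbackBilin (I := IM) (I' := IN) f (pullbackBilin (I := IP) (I' := IM) g b) y := by
  ext v w
  simp only [pullbackBilin_apply, Function.comp_apply]
  rw [mfderiv_comp y hg hf]
  rfl

/-- **The shielding predicate is invariant under pullback by a diffeomorphism.** Let `D` be
Kerr-shielded and let `Θ : X → X` be smooth with injective differentials and with a smooth
two-sided inverse `Ψ`. Then `Θ^* D = D.comap Θ` is Kerr-shielded: shielding chart `Ψ ∘ φ`, same
Kerr data `(M, a, r₁, T, ψ, ν)`; `(Ψ ∘ φ)^*(Θ^* h) = (Θ ∘ Ψ ∘ φ)^* h = φ^* h`. [folklore] -/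
theorem isKerrShielded_comap_of_inverse [Kerr.Facts] {D : InitialDataSet (𝓡 3) X}
    (hD : IsKerrShielded X D) (Θ : X → X) (hΘ : ContMDiff (𝓡 3) (𝓡 3) (∞ + 1) Θ)
    (hΘ' : ∀ u, Injective (mfderiv (𝓡 3) (𝓡 3) Θ u)) (Ψ : X → X)
    (hΨ : ContMDiff (𝓡 3) (𝓡 3) ∞ Ψ) (hΨΘ : ∀ x, Ψ (Θ x) = x) (hΘΨ : ∀ x, Θ (Ψ x) = x) :
    IsKerrShielded X (D.comap Θ hΘ hΘ') := by
  obtain ⟨M, a, r₁, hM, T, φ, ψ, ν, ha, hrm, hrp, hT, hcpt, hemb, hφs, hψT, hsp, hfun, hmet, hK⟩ := hD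
  have hΘs : ContMDiff (𝓡 3) (𝓡 3) ∞ Θ := hΘ.of_le le_self_add
  -- `Θ` as a homeomorphism with inverse `Ψ`
  let H : X ≃ₜ X :=
    { toFun := Θ
      invFun := Ψ
      left_inv := hΨΘ
      right_inv := hΘΨ
      continuous_toFun := hΘs.continuous
      continuous_invFun := hΨ.continuous }
  have hHsymm : ⇑H.symm = Ψ := rfl
  -- the new shielding chart
  have hφ's : ContMDiff 𝓘(ℝ, E3) (𝓡 3) ∞ (Ψ ∘ φ) := hΨ.comp hφs
  have hemb' : Topology.IsOpenEmbedding (Ψ ∘ φ) := by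
    rw [← hHsymm]
    exact H.symm.isOpenEmbedding.comp hemb
  have hcpt' : IsCompact (Set.range (Ψ ∘ φ))ᶜ := by
    have hbij : Bijective Ψ := by rw [← hHsymm]; exact H.symm.bijective
    rw [Set.range_comp, ← Set.image_compl_eq hbij]
    exact hcpt.image hΨ.continuous
  have hcomp : Θ ∘ (Ψ ∘ φ) = φ := funext fun y ↦ hΘΨ (φ y)
  -- the chain rule for the two pullbacks
  have hchain : ∀ (b : Π x : X, TangentSpace (𝓡 3) x →L[ℝ] TangentSpace (𝓡 3) x →L[ℝ] ℝ)
      (y : Kerr.slice a r₁),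
      pullbackBilin (I := 𝓡 3) (I' := 𝓘(ℝ, E3)) (Ψ ∘ φ)
          (pullbackBilin (I := 𝓡 3) (I' := 𝓡 3) Θ b) y =
        pullbackBilin (I := 𝓡 3) (I' := 𝓘(ℝ, E3)) φ b y := by
    intro b y
    have hΘd : MDifferentiableAt (𝓡 3) (𝓡 3) Θ ((Ψ ∘ φ) y) := (hΘs _).mdifferentiableAt (by simp)
    have hφd : MDifferentiableAt 𝓘(ℝ, E3) (𝓡 3) (Ψ ∘ φ) y := (hφ's y).mdifferentiableAt (by simp)
    rw [← pullbackBilin_comp_apply_of_mdifferentiableAt hΘd hφd b, hcomp]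
  refine ⟨M, a, r₁, hM, T, Ψ ∘ φ, ψ, ν, ha, hrm, hrp, hT, hcpt', hemb', hφ's, hψT, hsp, hfun,
    fun y ↦ ?_, fun y ↦ ?_⟩
  · -- metric clause: `(Θ^*D).h = Θ^* h`
    have hh : (D.comap Θ hΘ hΘ').h.inner = pullbackBilin (I := 𝓡 3) (I' := 𝓡 3) Θ D.h.inner := rfl
    rw [hh, hchain D.h.inner y]
    exact hmet y
  · -- second fundamental form clause: `(Θ^*D).k = Θ^* k`
    have hk : (D.comap Θ hΘ hΘ').k = pullbackBilin (I := 𝓡 3) (I' := 𝓡 3) Θ D.k := rfl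
    rw [hk, hchain D.k y]
    exact hK y

/-- **Breathing preserves shielding**: for breathing data `B` and any `t`, the breathed datum
`breatheFamily B D t = (breathe (σ t))^* D` of a Kerr-shielded `D` is Kerr-shielded (`|σ t|` is
below the inverse threshold, so `breathe (σ t)` has a smooth inverse, `AFEndUnbreathe`). [folklore] -/
theorem isKerrShielded_breatheFamily [Kerr.Facts] [T2Space X] {e : AFEnd X} {z₀ : E3} {r : ℝ}
    (B : AFEnd.BreathingData e z₀ r) {D : InitialDataSet (𝓡 3) X} (hD : IsKerrShielded X D) (t : ℝ) :
    IsKerrShielded X (AFEnd.breatheFamily B D t) := by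
  obtain ⟨Ψ, hΨ, h1, h2, -⟩ := AFEnd.exists_smooth_inverse_breathe B (AFEnd.abs_squash_lt_invScale B t)
  exact isKerrShielded_comap_of_inverse hD _ _ _ Ψ hΨ h1 h2

/-! ## §2 Geometry of the breathing ball inside the shell `{R < ‖coord‖ < R⋆}` -/

section Ball

variable (e : AFEnd X) {Rstar : ℝ} (hR : e.R < Rstar)

omit [IsManifold (𝓡 3) ∞ X] in
include hR in
/-- **A breathing ball fits into the shell `{R < ‖z‖ < R⋆}`**: centre `z₀ = (R + (R⋆ − R)/2) e₁`,
radius `r = (R⋆ − R)/8`, so that `r > 0`, `R + 2r < ‖z₀‖` and `‖z₀‖ + r ≤ R⋆`. [folklore] -/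
theorem exists_breathingData_le :
    ∃ (z₀ : E3) (r : ℝ), AFEnd.BreathingData e z₀ r ∧ ‖z₀‖ + r ≤ Rstar := by
  have hpos : 0 < e.R + (Rstar - e.R) / 2 := by linarith [e.R_pos]
  have hn : ‖(e.R + (Rstar - e.R) / 2) • (EuclideanSpace.single 0 1 : E3)‖ = e.R + (Rstar - e.R) / 2 := by
    rw [norm_smul, Real.norm_of_nonneg hpos.le]
    simp
  refine ⟨(e.R + (Rstar - e.R) / 2) • EuclideanSpace.single 0 1, (Rstar - e.R) / 8, ⟨by linarith, ?_⟩, ?_⟩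
  · rw [hn]; linarith
  · rw [hn]; linarith

omit [IsManifold (𝓡 3) ∞ X] in
/-- Points of the carrier of a ball with `‖z₀‖ + r ≤ R⋆` have chart radius `< R⋆`, hence lie
outside every far region `e.far R`, `R ≥ R⋆`. [folklore] -/
theorem not_mem_far_of_mem_carrier {z₀ : E3} {r : ℝ} (hzr : ‖z₀‖ + r ≤ Rstar) {R : ℝ} (hRR : Rstar ≤ R)
    {x : X} (hx : x ∈ e.breatheCarrier z₀ r) : x ∉ e.far R := by
  intro hfar
  obtain ⟨-, hlt⟩ := e.mem_far_iff_coord.1 hfar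
  have hball := hx.2
  rw [mem_ball, dist_eq_norm] at hball
  have h1 : ‖e.coord x‖ ≤ ‖e.coord x - z₀‖ + ‖z₀‖ := norm_le_norm_sub_add _ _
  linarith

end Ball

/-! ## §3 The stub -/

/-- **Stub `stub_breathing`** (registered signature, line `receding-annulus-universal-collar`, crux
item stmt-FinalStateConjecture-10052): the two-parameter family `S (R, t) = Φ_t^* (P R)`, the
one-parameter family `E t = Φ_t^* d` through `d`, and an injective marker, where `Φ_t` are the
breathing diffeomorphisms supported in a coordinate ball of the shell `{R < ‖coord‖ < R⋆}`.
[folklore] -/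
theorem stub_breathing : ∀ [Kerr.Facts] (X : Type) [TopologicalSpace X] [ChartedSpace E3 X]
    [IsManifold (𝓡 3) ∞ X] [T2Space X] [SecondCountableTopology X] [ConnectedSpace X]
    (d : InitialDataSet (𝓡 3) X) (e : AFEnd X) (Rstar : ℝ) (P : ℝ → InitialDataSet (𝓡 3) X),
    e.R < Rstar → SmoothSectionsOn 𝓘(ℝ, ℝ) P {p : ℝ × X | Rstar < p.1} →
    (∀ R : ℝ, Rstar < R → P R ∈ admissibleVacuumData X ∧ IsKerrShielded X (P R) ∧
      ∀ x ∉ e.far R, AgreeAt (P R) d x) →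
    ∃ (S : ℝ × ℝ → InitialDataSet (𝓡 3) X) (E : ℝ → InitialDataSet (𝓡 3) X) (x₀ : X)
      (v₀ : TangentSpace (𝓡 3) x₀),
      SmoothSectionsOn (𝓘(ℝ, ℝ).prod 𝓘(ℝ, ℝ)) S {p : (ℝ × ℝ) × X | Rstar < p.1.1} ∧
      SmoothSectionsOn 𝓘(ℝ, ℝ) E (Set.univ : Set (ℝ × X)) ∧ E 0 = d ∧
      (∀ R t : ℝ, Rstar < R → ∀ x ∉ e.far R, AgreeAt (S (R, t)) (E t) x) ∧ x₀ ∉ e.far Rstar ∧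
      Set.InjOn (fun t : ℝ ↦ (E t).h.inner x₀ v₀ v₀) (Set.Ioo (-1) 1) ∧
      ∀ R t : ℝ, Rstar < R → |t| < 1 → S (R, t) ∈ admissibleVacuumData X ∧ IsKerrShielded X (S (R, t)) := by
  intro _ X _ _ _ _ _ _ d e Rstar P hR hP hPR
  -- the breathing ball and the breathing families
  obtain ⟨z₀, r, B, hzr⟩ := exists_breathingData_le e hR
  let E : ℝ → InitialDataSet (𝓡 3) X := fun t ↦ AFEnd.breatheFamily B d t
  let S : ℝ × ℝ → InitialDataSet (𝓡 3) X := fun q ↦ AFEnd.breatheFamily B (P q.1) q.2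
  let x₀ : X := e.dataChartExt z₀
  let v₀ : TangentSpace (𝓡 3) x₀ := (EuclideanSpace.single 0 1 : E3)
  have hv₀ : v₀ ≠ 0 := by
    intro h
    have h1 : ‖(EuclideanSpace.single (0 : Fin 3) (1 : ℝ) : E3)‖ = 1 := by simp
    have h2 : (EuclideanSpace.single (0 : Fin 3) (1 : ℝ) : E3) = 0 := h
    rw [h2, norm_zero] at h1
    exact zero_ne_one h1
  -- `P R = d` on the carrier (`R > R⋆`), and at breathed points of the complement of `far R`
  have hcarrier : ∀ {R : ℝ}, Rstar < R → ∀ {x : X}, x ∈ e.breatheCarrier z₀ r → x ∉ e.far R :=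
    fun hRR _ hx ↦ not_mem_far_of_mem_carrier e hzr hRR.le hx
  have hagree_breathe : ∀ {R : ℝ}, Rstar < R → ∀ (t : ℝ) {x : X}, x ∉ e.far R →
      AgreeAt (P R) d (e.breathe z₀ r (AFEnd.squash B t) x) := by
    intro R hRR t x hx
    refine (hPR R hRR).2.2 _ ?_
    by_cases hxc : x ∈ e.breatheCarrier z₀ r
    · exact hcarrier hRR
        ⟨(AFEnd.breathe_mem_and_coord B (AFEnd.abs_squash_lt_scale B t).2 hxc).1, by
          rw [(AFEnd.breathe_mem_and_coord B (AFEnd.abs_squash_lt_scale B t).2 hxc).2]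
          exact AFEnd.phi_mem_ball_of_lt_invScale (AFEnd.abs_squash_lt_invScale B t) hxc.2⟩
    · rwa [e.breathe_of_not_mem hxc]
  -- `S (R, t)` and `E t` agree wherever `P R` and `d` agree at the breathed point
  have hSE : ∀ {R : ℝ} (t : ℝ) {x : X}, AgreeAt (P R) d (e.breathe z₀ r (AFEnd.squash B t) x) →
      AgreeAt (S (R, t)) (E t) x := by
    intro R t x hag
    refine ⟨?_, ?_⟩
    · ext v w
      rw [AFEnd.breatheFamily_h_inner, AFEnd.breatheFamily_h_inner, hag.1]
    · ext v w
      rw [AFEnd.breatheFamily_k, AFEnd.breatheFamily_k, hag.2]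
  -- the section maps of `E`
  have hEh := AFEnd.contMDiff_breatheFamily_h B d
  have hEk := AFEnd.contMDiff_breatheFamily_k B d
  refine ⟨S, E, x₀, v₀, ?_, ⟨hEh.contMDiffOn, hEk.contMDiffOn⟩, AFEnd.breatheFamily_zero B d,
    fun R t hRR x hx ↦ hSE t (hagree_breathe hRR t hx), ?_, ?_, fun R t hRR _ ↦ ⟨?_, ?_⟩⟩
  · -- joint smoothness of `S` on `{R⋆ < R}`
    have hopen : IsOpen {p : (ℝ × ℝ) × X | Rstar < p.1.1} :=
      isOpen_lt continuous_const (continuous_fst.comp continuous_fst)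
    have hproj₂ : ContMDiff ((𝓘(ℝ, ℝ).prod 𝓘(ℝ, ℝ)).prod (𝓡 3)) (𝓘(ℝ, ℝ).prod (𝓡 3)) ∞
        (fun q : (ℝ × ℝ) × X ↦ (q.1.2, q.2)) :=
      (contMDiff_snd.comp contMDiff_fst).prodMk contMDiff_snd
    have hproj₁ : ContMDiff ((𝓘(ℝ, ℝ).prod 𝓘(ℝ, ℝ)).prod (𝓡 3)) (𝓘(ℝ, ℝ).prod (𝓡 3)) ∞
        (fun q : (ℝ × ℝ) × X ↦ (q.1.1, q.2)) :=
      (contMDiff_fst.comp contMDiff_fst).prodMk contMDiff_snd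
    -- generic argument for a section `sec` (`h` or `k`)
    have key : ∀ (secS : Π q : (ℝ × ℝ) × X, TangentSpace (𝓡 3) q.2 →L[ℝ] TangentSpace (𝓡 3) q.2 →L[ℝ] ℝ)
        (secE : Π q : ℝ × X, TangentSpace (𝓡 3) q.2 →L[ℝ] TangentSpace (𝓡 3) q.2 →L[ℝ] ℝ)
        (secP : Π q : ℝ × X, TangentSpace (𝓡 3) q.2 →L[ℝ] TangentSpace (𝓡 3) q.2 →L[ℝ] ℝ),
        ContMDiff (𝓘(ℝ, ℝ).prod (𝓡 3)) ((𝓡 3).prod 𝓘(ℝ, E3 →L[ℝ] E3 →L[ℝ] ℝ)) ∞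
          (fun q : ℝ × X ↦ TotalSpace.mk' (E3 →L[ℝ] E3 →L[ℝ] ℝ)
            (E := fun x : X ↦ TangentSpace (𝓡 3) x →L[ℝ] TangentSpace (𝓡 3) x →L[ℝ] ℝ) q.2 (secE q)) →
        ContMDiffOn (𝓘(ℝ, ℝ).prod (𝓡 3)) ((𝓡 3).prod 𝓘(ℝ, E3 →L[ℝ] E3 →L[ℝ] ℝ)) ∞
          (fun q : ℝ × X ↦ TotalSpace.mk' (E3 →L[ℝ] E3 →L[ℝ] ℝ)
            (E := fun x : X ↦ TangentSpace (𝓡 3) x →L[ℝ] TangentSpace (𝓡 3) x →L[ℝ] ℝ) q.2 (secP q))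
          {p : ℝ × X | Rstar < p.1} →
        (∀ q : (ℝ × ℝ) × X, Rstar < q.1.1 → q.2 ∈ e.breatheCarrier z₀ r → secS q = secE (q.1.2, q.2)) →
        (∀ q : (ℝ × ℝ) × X, q.2 ∉ AFEnd.breatheCore e z₀ r → secS q = secP (q.1.1, q.2)) →
        ContMDiffOn ((𝓘(ℝ, ℝ).prod 𝓘(ℝ, ℝ)).prod (𝓡 3)) ((𝓡 3).prod 𝓘(ℝ, E3 →L[ℝ] E3 →L[ℝ] ℝ)) ∞
          (fun q : (ℝ × ℝ) × X ↦ TotalSpace.mk' (E3 →L[ℝ] E3 →L[ℝ] ℝ)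
            (E := fun x : X ↦ TangentSpace (𝓡 3) x →L[ℝ] TangentSpace (𝓡 3) x →L[ℝ] ℝ) q.2 (secS q))
          {p : (ℝ × ℝ) × X | Rstar < p.1.1} := by
      intro secS secE secP hE hP hcar hcore q hq
      have hq' : Rstar < q.1.1 := hq
      apply ContMDiffAt.contMDiffWithinAt
      by_cases hx : q.2 ∈ e.breatheCarrier z₀ r
      · -- on the carrier `S = E`
        have hsm : ContMDiffAt ((𝓘(ℝ, ℝ).prod 𝓘(ℝ, ℝ)).prod (𝓡 3)) ((𝓡 3).prod 𝓘(ℝ, E3 →L[ℝ] E3 →L[ℝ] ℝ)) ∞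
            (fun q : (ℝ × ℝ) × X ↦ TotalSpace.mk' (E3 →L[ℝ] E3 →L[ℝ] ℝ)
              (E := fun x : X ↦ TangentSpace (𝓡 3) x →L[ℝ] TangentSpace (𝓡 3) x →L[ℝ] ℝ) q.2
                (secE (q.1.2, q.2))) q :=
          (hE (q.1.2, q.2)).comp q (hproj₂ q)
        refine hsm.congr_of_eventuallyEq ?_
        have hev₁ : ∀ᶠ p : (ℝ × ℝ) × X in 𝓝 q, Rstar < p.1.1 := hopen.mem_nhds hq'
        have hev₂ : ∀ᶠ p : (ℝ × ℝ) × X in 𝓝 q, p.2 ∈ e.breatheCarrier z₀ r :=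
          (continuousAt_snd (p := q)).preimage_mem_nhds ((e.isOpen_breatheCarrier z₀ r).mem_nhds hx)
        have hev := hev₁.and hev₂
        filter_upwards [hev] with p hp
        rw [hcar p hp.1 hp.2]
      · -- off the carrier, hence off the moved set: `S = P`
        have hK : q.2 ∉ AFEnd.breatheCore e z₀ r := fun h ↦ hx (AFEnd.breatheCore_subset_carrier B h)
        have hmem : (q.1.1, q.2) ∈ {p : ℝ × X | Rstar < p.1} := hq'
        have hPat : ContMDiffAt (𝓘(ℝ, ℝ).prod (𝓡 3)) ((𝓡 3).prod 𝓘(ℝ, E3 →L[ℝ] E3 →L[ℝ] ℝ)) ∞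
            (fun q : ℝ × X ↦ TotalSpace.mk' (E3 →L[ℝ] E3 →L[ℝ] ℝ)
              (E := fun x : X ↦ TangentSpace (𝓡 3) x →L[ℝ] TangentSpace (𝓡 3) x →L[ℝ] ℝ) q.2 (secP q))
            (q.1.1, q.2) :=
          (hP _ hmem).contMDiffAt ((isOpen_lt continuous_const continuous_fst).mem_nhds hmem)
        have hsm : ContMDiffAt ((𝓘(ℝ, ℝ).prod 𝓘(ℝ, ℝ)).prod (𝓡 3)) ((𝓡 3).prod 𝓘(ℝ, E3 →L[ℝ] E3 →L[ℝ] ℝ)) ∞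
            (fun q : (ℝ × ℝ) × X ↦ TotalSpace.mk' (E3 →L[ℝ] E3 →L[ℝ] ℝ)
              (E := fun x : X ↦ TangentSpace (𝓡 3) x →L[ℝ] TangentSpace (𝓡 3) x →L[ℝ] ℝ) q.2
                (secP (q.1.1, q.2))) q :=
          hPat.comp q (hproj₁ q)
        refine hsm.congr_of_eventuallyEq ?_
        have hev : ∀ᶠ p : (ℝ × ℝ) × X in 𝓝 q, p.2 ∉ AFEnd.breatheCore e z₀ r :=
          (continuousAt_snd (p := q)).preimage_mem_nhds
            ((AFEnd.isCompact_breatheCore B).isClosed.isOpen_compl.mem_nhds hK)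
        filter_upwards [hev] with p hp
        rw [hcore p hp]
    refine ⟨key (fun q ↦ (S q.1).h.inner q.2) (fun q ↦ (E q.1).h.inner q.2) (fun q ↦ (P q.1).h.inner q.2)
        hEh hP.1 (fun q hq hx ↦ ?_) (fun q hx ↦ ?_),
      key (fun q ↦ (S q.1).k q.2) (fun q ↦ (E q.1).k q.2) (fun q ↦ (P q.1).k q.2)
        hEk hP.2 (fun q hq hx ↦ ?_) (fun q hx ↦ ?_)⟩
    · exact (hSE q.1.2 (hagree_breathe hq q.1.2 (hcarrier hq hx))).1
    · exact (AFEnd.breatheFamily_eq_of_not_mem_core B (P q.1.1) q.1.2 hx).1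
    · exact (hSE q.1.2 (hagree_breathe hq q.1.2 (hcarrier hq hx))).2
    · exact (AFEnd.breatheFamily_eq_of_not_mem_core B (P q.1.1) q.1.2 hx).2
  · -- the marker point lies below `R⋆`
    exact not_mem_far_of_mem_carrier e hzr le_rfl (AFEnd.center_mem B).1
  · -- the marker is injective
    exact (AFEnd.injective_marker B d hv₀).injOn
  · -- admissibility of `S (R, t)`
    obtain ⟨hPadm, -, -⟩ := hPR R hRR
    have hvacP : ∀ [(P R).metric.HasLeviCivita], (P R).IsVacuumConstraintSolution := fun {inst} ↦ (hPadm.1).1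
    refine InitialDataSet.mem_admissibleVacuumData_of_agree_off_compact hPadm ?_
      (AFEnd.isCompact_breatheCore B) (fun x hx ↦ AFEnd.breatheFamily_eq_of_not_mem_core B (P R) t hx)
    intro inst
    haveI : (P R).metric.HasLeviCivita := (P R).metric.hasLeviCivita
    exact AFEnd.isVacuumConstraintSolution_breatheFamily B (P R) hvacP t
  · -- shielding of `S (R, t)`
    exact isKerrShielded_breatheFamily B (hPR R hRR).2.1 t

end Summit.FinalStateConjecture.FinalStateConjecture.Theorems.SwallowTheDatum.ParametricKerrBurial

end
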